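import Summits.ResolutionOfSingularities.ResolutionOfSingularities.Theorems.FrobeniusLadderFInjectiveMacaulayficationFedderAlongCoordinateLine
import Mathlib.RingTheory.Polynomial.UniqueFactorization
import HarnessLib

/-!
# Fedder's test uniformly along a coordinate line, OFF the origin of the line (general `n`, `p`)

Support file for crux stmt-ResolutionOfSingularities-15315 (`FrobeniusLadder.FInjectiveMacaulayfication`), chain w45a, hole #3 (first
consumer: the calibration «cusp-degenerate E8-line», res-L1-w45a-plan-1 R12.2 (i), seat res-L1-w45a-stub-2). The landed
`FedderAlongCoordinateLine.not_mem_span_pow` (line `Sketch`, §14) certifies `g^(p-1) ∉ (Xⱼ^p (j ≠ ℓ), c(X_ℓ)^p)` at EVERY closed point of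
the line `L = V(Xⱼ : j ≠ ℓ)` when the `X^a`-extraction `u(X_ℓ)` of `g^(p-1)` has degree `< p`. When the singular line passes through a
WORSE point at its origin (the typical hole-#3 picture: a good curve of `A₂ × line` points running into the bad stratum), `u` is
`κ·X_ℓ^m` with `m ≥ p` and that lemma is silent; but off the origin (`X_ℓ ∉ P`) the same extraction still decides:
* `not_mem_span_pow_of_not_X_dvd` — if `u = κ T^m`, `κ ≠ 0`, and the point's generator `c` is NOT divisible by `T`, then
  `g^(p-1) ∉ (Xⱼ^p (j ≠ ℓ), c(X_ℓ)^p)` (an irreducible factor of `c` dividing `κT^m` would be associated to `T`);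
* `exists_gen_not_X_dvd` — a maximal ideal containing the `Xⱼ`, `j ≠ ℓ`, but not `X_ℓ` is `(Xⱼ (j ≠ ℓ), c(X_ℓ))` with `c` a non-unit
  NOT divisible by `T` (strip the `T`-power off the generator of `exists_eq_span_of_X_mem`).
[OURS · L1 W4.5a] AI-written; AI review is weaker than expert review. No statement of Hironaka2017 is used; no external fact.
No definitions, no named facts. [folklore]
-/

set_option linter.dupNamespace false

noncomputable section

open MvPolynomial

namespace Summit.ResolutionOfSingularities.ResolutionOfSingularities.Theorems.FInjectiveMacaulayfication.FedderAlongCoordinateLineOffOrigin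

open Summit.ResolutionOfSingularities.ResolutionOfSingularities.Theorems.FInjectiveMacaulayfication
open FedderAlongCoordinateLine

variable {k : Type} [Field k]

/-! ## Fedder along a coordinate line, OFF the origin of the line -/

/-- **Off-origin extraction certificate.** `a_ℓ = 0`, all `a_j < p`, `c ∈ k[T]` a non-unit NOT divisible by `T`, and `f` whose
`X^a`-extraction is `κ·T^m` (`κ ≠ 0`): then `f ∉ (Xⱼ^p (j ≠ ℓ), c(X_ℓ)^p)` — the extraction maps the ideal into `(c^p)`, and an
irreducible factor of `c` dividing `κ T^m` would be associated to `T`. [folklore] -/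
theorem not_mem_span_pow_of_not_X_dvd {n : ℕ} {ℓ : Fin n} (p : ℕ) (hp : 0 < p) (a : Fin n →₀ ℕ) (ha : a ℓ = 0)
    (hap : ∀ j : Fin n, a j < p) (ψ : Polynomial k →ₐ[k] MvPolynomial (Fin n) k)
    (hψ : ψ = Polynomial.aeval (X ℓ : MvPolynomial (Fin n) k)) (c : Polynomial k) (hc : ¬IsUnit c)
    (hcT : ¬ Polynomial.X ∣ c) (f : MvPolynomial (Fin n) k) (m : ℕ) (κ : k) (hκ : κ ≠ 0)
    (hcoeff : ∀ t : ℕ, MvPolynomial.coeff (a + Finsupp.single ℓ t) f = if t = m then κ else 0) :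
    f ∉ Ideal.span (Set.range fun j : Fin n => (if j = ℓ then ψ c else X j) ^ p) := by
  classical
  intro hmem
  obtain ⟨E, hE⟩ := exists_extraction (k := k) ℓ a
  have hEf : E f = Polynomial.C κ * Polynomial.X ^ m := by
    ext t
    rw [hE, hcoeff, Polynomial.coeff_C_mul_X_pow]
  obtain ⟨h, hh⟩ := Ideal.mem_span_range_iff_exists_fun.mp hmem
  have hEf' : E f = E (h ℓ) * c ^ p := by
    rw [← hh, map_sum, Finset.sum_eq_single ℓ]
    · rw [if_pos rfl, ← map_pow, extraction_mul_aeval hE ha ψ hψ]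
    · intro j _ hj
      rw [if_neg hj, extraction_mul_X_pow hE hj (hap j)]
    · intro h'
      exact absurd (Finset.mem_univ ℓ) h'
  have hc0 : c ≠ 0 := by
    rintro rfl
    rw [zero_pow hp.ne', mul_zero, hEf] at hEf'
    exact (mul_ne_zero (Polynomial.C_ne_zero.mpr hκ) (pow_ne_zero m Polynomial.X_ne_zero)) hEf'
  obtain ⟨π, hπirr, hπc⟩ := WfDvdMonoid.exists_irreducible_factor hc hc0
  have hπprime : Prime π := hπirr.prime
  have hπdvd : π ∣ Polynomial.C κ * Polynomial.X ^ m := by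
    rw [← hEf, hEf']
    exact Dvd.dvd.mul_left (dvd_pow hπc hp.ne') _
  have hπX : π ∣ Polynomial.X := by
    rcases hπprime.dvd_or_dvd hπdvd with h1 | h1
    · exact absurd (isUnit_of_dvd_unit h1 (Polynomial.isUnit_C.mpr (Ne.isUnit hκ))) hπirr.1
    · exact hπprime.dvd_of_dvd_pow h1
  have hassoc : Associated π Polynomial.X := hπirr.associated_of_dvd Polynomial.irreducible_X hπX
  exact hcT (hassoc.symm.dvd.trans hπc)

/-- **The closed points of a coordinate line off its origin.** A maximal ideal `P` of `k[X]` containing the `Xⱼ`, `j ≠ ℓ`, but NOT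
`X_ℓ` is `(Xⱼ (j ≠ ℓ), c(X_ℓ))` for a non-unit `c ∈ k[T]` NOT divisible by `T` (strip the `T`-power off the generator of
`exists_eq_span_of_X_mem`: `X_ℓ^m · c'(X_ℓ) ∈ P` with `X_ℓ ∉ P` puts `c'(X_ℓ)` in `P`). [folklore] -/
theorem exists_gen_not_X_dvd {n : ℕ} (ℓ : Fin n) (ψ : Polynomial k →ₐ[k] MvPolynomial (Fin n) k)
    (hψ : ψ = Polynomial.aeval (X ℓ : MvPolynomial (Fin n) k)) (P : Ideal (MvPolynomial (Fin n) k)) [hP : P.IsMaximal]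
    (hX : ∀ j : Fin n, j ≠ ℓ → (X j : MvPolynomial (Fin n) k) ∈ P) (hXℓ : (X ℓ : MvPolynomial (Fin n) k) ∉ P) :
    ∃ c : Polynomial k, ¬IsUnit c ∧ ¬ Polynomial.X ∣ c ∧
      P = Ideal.span (Set.range fun j : Fin n => if j = ℓ then ψ c else X j) := by
  classical
  obtain ⟨c, hcu, hPc⟩ := exists_eq_span_of_X_mem k n ℓ ψ hψ P hX
  have hc0 : c ≠ 0 := by
    rintro rfl
    -- then `P = (Xⱼ : j ≠ ℓ)` would not contain `ψ T^0`… simplest: `X_ℓ · 0`-free argument via maximality: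
    -- `P ⊔ (X_ℓ) = ⊤` is impossible since `P ⊔ (X_ℓ) ≤ (X₀,…,X_{n-1}) ≠ ⊤`.
    have hle : P ⊔ Ideal.span {(X ℓ : MvPolynomial (Fin n) k)} ≤ Ideal.span (Set.range (X : Fin n → MvPolynomial (Fin n) k)) := by
      refine sup_le ?_ ?_
      · rw [hPc, Ideal.span_le]
        rintro _ ⟨j, rfl⟩
        dsimp only
        by_cases hj : j = ℓ
        · rw [if_pos hj, map_zero]; exact Ideal.zero_mem _
        · rw [if_neg hj]; exact Ideal.subset_span ⟨j, rfl⟩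
      · rw [Ideal.span_le, Set.singleton_subset_iff]; exact Ideal.subset_span ⟨ℓ, rfl⟩
    have hlt : P < P ⊔ Ideal.span {(X ℓ : MvPolynomial (Fin n) k)} :=
      lt_of_le_of_ne le_sup_left fun h => hXℓ (h ▸ Ideal.mem_sup_right (Ideal.mem_span_singleton_self _))
    have htop := hP.1.2 _ hlt
    have hne : Ideal.span (Set.range (X : Fin n → MvPolynomial (Fin n) k)) ≠ ⊤ := by
      rw [Ne, Ideal.eq_top_iff_one]
      intro h1
      have h := congrArg (MvPolynomial.eval (0 : Fin n → k)) (show (1 : MvPolynomial (Fin n) k) = 1 from rfl)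
      have hmem : ∀ q ∈ Ideal.span (Set.range (X : Fin n → MvPolynomial (Fin n) k)), MvPolynomial.eval (0 : Fin n → k) q = 0 := by
        intro q hq
        refine Submodule.span_induction ?_ ?_ ?_ ?_ hq
        · rintro _ ⟨j, rfl⟩; simp
        · simp
        · intro x y _ _ hx hy; rw [map_add, hx, hy, add_zero]
        · intro r x _ hx; rw [smul_eq_mul, map_mul, hx, mul_zero]
      have := hmem 1 h1
      rw [map_one] at this
      exact one_ne_zero this
    exact hne (top_le_iff.mp (htop ▸ hle))
  -- strip the `T`-power: `c = T^m * c'`, `T ∤ c'`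
  obtain ⟨c', hc', hcT⟩ := Polynomial.exists_eq_pow_rootMultiplicity_mul_and_not_dvd c hc0 0
  rw [map_zero, sub_zero] at hc' hcT
  set m := Polynomial.rootMultiplicity 0 c with hm
  have hψc' : ψ c' ∈ P := by
    have hψc : ψ c ∈ P := by
      rw [hPc]; exact Ideal.subset_span ⟨ℓ, by simp⟩
    rw [hc', map_mul, map_pow, hψ, Polynomial.aeval_X] at hψc
    rw [hψ]
    rcases hP.isPrime.mem_or_mem hψc with h1 | h1
    · exact absurd (hP.isPrime.mem_of_pow_mem _ h1) hXℓ
    · exact h1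
  have hc'u : ¬IsUnit c' := fun hu => hP.ne_top (P.eq_top_of_isUnit_mem hψc' (hu.map ψ))
  refine ⟨c', hc'u, hcT, le_antisymm ?_ ?_⟩
  · rw [hPc, Ideal.span_le]
    rintro _ ⟨j, rfl⟩
    dsimp only
    by_cases hj : j = ℓ
    · rw [if_pos hj, hc', map_mul, map_pow]
      exact Ideal.mul_mem_left _ _ (Ideal.subset_span ⟨ℓ, by simp⟩)
    · rw [if_neg hj]; exact Ideal.subset_span ⟨j, by simp [hj]⟩
  · rw [Ideal.span_le]
    rintro _ ⟨j, rfl⟩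
    dsimp only
    by_cases hj : j = ℓ
    · rw [if_pos hj]; exact hψc'
    · rw [if_neg hj]; exact hX j hj

end Summit.ResolutionOfSingularities.ResolutionOfSingularities.Theorems.FInjectiveMacaulayfication.FedderAlongCoordinateLineOffOrigin

end
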